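import Summits.Ventures.PackingBounds.Configurations.ListConfigTwoOrbit
import Summits.Ventures.PackingBounds.Conjectures.DiploSimplexRiesz
import Mathlib.NumberTheory.Zsqrtd.ToReal
import HarnessLib
import HarnessLib.Audit.Tags

/-!
# `(5, 12)`: the Petersen code plus two poles TIES the diplo-simplex `D_5` at Riesz `s = 2` and beats it for `s = 4`

Framing: lottery ticket; floor = certified bounds/negative ranges. Venture `PackingBounds` (cell `pub-packcert`, seat
`pub-packcert-energy`, gen 26) — kernel facts about the `n = 5` clause of the diplo-simplex conjectures
(`Conjectures/DiploSimplexRiesz.lean`, Conjecture B₅) and a CORRECTION of its typed form.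

THE COMPETITOR. `X ⊂ S⁴`: the ten points of the Petersen code (`5(e_i + e_j) - 2·𝟙`, `i < j`, in `𝟙^⊥ ⊂ ℝ⁵`; inner
products `1/6`, `-2/3`) together with the two poles `±𝟙/√5` — twelve unit vectors of `ℝ⁵` with energy
`Σ_{x ≠ y} a(⟪x,y⟫) = 2 a(-1) + 40 a(0) + 60 a(1/6) + 30 a(-2/3)` for every potential `a` (`PetersenPoles.energy_pts`; coordinates over
`ℤ[√6]` at scale `√30`, two-orbit kernel checks of `ListConfigTwoOrbit.lean`).
THE TIE. For the Riesz potential `‖x - y‖^{-2}`: `E_2(X) = 2/4 + 40/2 + 60·(3/5) + 30·(3/10) = 131/2` and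
`E_2(D_5) = 12 (1/4 + 5·(5/12) + 5·(5/8)) = 131/2` (`dipValue_five_two`), EXACTLY EQUAL. Hence `¬ DiploRigid 5 2` (`X` has the
inner product `0 ∉ {-1, ±1/5}` at energy `= dipValue 5 2`; `not_diploRigid_five_two`). For `s = 4`:
`E_4(X) = 1377/40 = 34.425 < E_4(D_5) = 1661/48 = 34.604…` (`not_diploMinimises_five_four`).
NUMERICS (gen 26, seat folder work/negative/opt_s.py; 10–16 random starts, gradient descent): the `(5,12)` Riesz-`s` optimum is
`D_5` for `s = 0.5, 1, 1.5, 1.9` (second-best family `X`, e.g. `67.72590` vs `E_{1.9}(D_5) = 67.72565`), the two TIE at `s = 2`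
(`65.5` both), and `X` wins for `s = 2.1` (`63.35160 < 63.35739`), `3` (`47.20712 < 47.28378`), `4`. So the threshold of Conjecture B at
`n = 5` is, numerically, EXACTLY `s*(5) = 2`, realised by an exact energy tie — not `1 ≤ s*(5) < 2` as in PAPER-diplo-g25 §18.3 and
in the typed `Conjectures.ConjectureB5` (which, if `D_5` does minimise at `s = 2` as the tie suggests, is FALSE as stated: it forces
`s* ≥ 2`). The corrected typed form is `ConjectureB5two` below (`DiploMinimises 5 s ↔ s ≤ 2`); `ConjectureB5` is superseded.

## References
* B. Ballinger et al., Experiment. Math. 18 (2009) 257–283, §3.4 ('suboptimal for `3 ≤ n ≤ 5`', harmonic `s = 3` at `n = 5`).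
  [`BallingerEtAl2009`]
* J. H. Conway, N. J. A. Sloane, *Sphere Packings, Lattices and Groups*, Ch. 9 Table 9.2 (the Petersen code). [`ConwaySloane1999`]
-/

noncomputable section

open Finset
open scoped RealInnerProductSpace

namespace Summit.Ventures.PackingBounds.Conjectures

open Summit.Ventures.PackingBounds.Config

/-- For unit vectors: `‖x - y‖^{-2} = (2 - 2⟪x,y⟫)⁻¹`. [folklore] -/
private theorem norm_sub_rpow_neg_two {m : ℕ} {x y : EuclideanSpace ℝ (Fin m)} (hx : ‖x‖ = 1) (hy : ‖y‖ = 1) :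
    ‖x - y‖ ^ (-(2 : ℝ)) = (2 - 2 * inner ℝ x y)⁻¹ := by
  have hsq : ‖x - y‖ ^ 2 = 2 - 2 * inner ℝ x y := by rw [norm_sub_sq_real, hx, hy]; ring
  rw [Real.rpow_neg (norm_nonneg _), Real.rpow_two, hsq]

/-- For unit vectors: `‖x - y‖^{-4} = ((2 - 2⟪x,y⟫)²)⁻¹`. [folklore] -/
private theorem norm_sub_rpow_neg_four {m : ℕ} {x y : EuclideanSpace ℝ (Fin m)} (hx : ‖x‖ = 1) (hy : ‖y‖ = 1) :
    ‖x - y‖ ^ (-(4 : ℝ)) = ((2 - 2 * inner ℝ x y) ^ 2)⁻¹ := by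
  have hsq : ‖x - y‖ ^ 2 = 2 - 2 * inner ℝ x y := by rw [norm_sub_sq_real, hx, hy]; ring
  rw [Real.rpow_neg (norm_nonneg _), show (4 : ℝ) = ((4 : ℕ) : ℝ) by norm_num, Real.rpow_natCast, ← hsq]
  ring

/-- `√q ^ {-2} = q⁻¹` for `q ≥ 0`. [folklore] -/
private theorem sqrt_rpow_neg_two {q : ℝ} (hq : 0 ≤ q) : Real.sqrt q ^ (-(2 : ℝ)) = q⁻¹ := by
  rw [Real.rpow_neg (Real.sqrt_nonneg _), Real.rpow_two, Real.sq_sqrt hq]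

/-- `√q ^ {-4} = (q²)⁻¹` for `q ≥ 0`. [folklore] -/
private theorem sqrt_rpow_neg_four {q : ℝ} (hq : 0 ≤ q) : Real.sqrt q ^ (-(4 : ℝ)) = (q ^ 2)⁻¹ := by
  rw [Real.rpow_neg (Real.sqrt_nonneg _), show (4 : ℝ) = ((4 : ℕ) : ℝ) by norm_num, Real.rpow_natCast,
    show (4 : ℕ) = 2 * 2 by norm_num, pow_mul, Real.sq_sqrt hq]

namespace PetersenPoles

/-- `0 ≤ 6`. -/
private theorem hd : (0 : ℤ) ≤ 6 := by norm_num

/-- `6` is not a square. -/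
private theorem d_not_square : ∀ n : ℤ, (6 : ℤ) ≠ n * n := by
  intro n h
  have h1 : n.natAbs * n.natAbs = 6 := by
    have := Int.natAbs_mul_self' n; omega
  have h2 : n.natAbs ≤ 3 := by nlinarith
  interval_cases n.natAbs <;> omega

/-- `(√6)² = 6`. -/
private theorem hX : Real.sqrt 6 ^ 2 = 6 := Real.sq_sqrt (by norm_num)

/-- The Petersen code `5(e_i + e_j) - 2·𝟙` (`i < j`) in `𝟙^⊥ ⊂ ℝ⁵`, squared norm `30`, over `ℤ[√6]`.
[cite: ConwaySloane1999, Ch. 9 Table 9.2] -/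
def rows₁ : List (List (Zsqrtd 6)) := [
  [⟨3, 0⟩, ⟨3, 0⟩, ⟨-2, 0⟩, ⟨-2, 0⟩, ⟨-2, 0⟩],
  [⟨3, 0⟩, ⟨-2, 0⟩, ⟨3, 0⟩, ⟨-2, 0⟩, ⟨-2, 0⟩],
  [⟨3, 0⟩, ⟨-2, 0⟩, ⟨-2, 0⟩, ⟨3, 0⟩, ⟨-2, 0⟩],
  [⟨3, 0⟩, ⟨-2, 0⟩, ⟨-2, 0⟩, ⟨-2, 0⟩, ⟨3, 0⟩],
  [⟨-2, 0⟩, ⟨3, 0⟩, ⟨3, 0⟩, ⟨-2, 0⟩, ⟨-2, 0⟩],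
  [⟨-2, 0⟩, ⟨3, 0⟩, ⟨-2, 0⟩, ⟨3, 0⟩, ⟨-2, 0⟩],
  [⟨-2, 0⟩, ⟨3, 0⟩, ⟨-2, 0⟩, ⟨-2, 0⟩, ⟨3, 0⟩],
  [⟨-2, 0⟩, ⟨-2, 0⟩, ⟨3, 0⟩, ⟨3, 0⟩, ⟨-2, 0⟩],
  [⟨-2, 0⟩, ⟨-2, 0⟩, ⟨3, 0⟩, ⟨-2, 0⟩, ⟨3, 0⟩],
  [⟨-2, 0⟩, ⟨-2, 0⟩, ⟨-2, 0⟩, ⟨3, 0⟩, ⟨3, 0⟩]]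

/-- The two poles `±√6·𝟙` (squared norm `30`; unit vectors `±𝟙/√5`). -/
def rows₂ : List (List (Zsqrtd 6)) := [
  [⟨0, 1⟩, ⟨0, 1⟩, ⟨0, 1⟩, ⟨0, 1⟩, ⟨0, 1⟩],
  [⟨0, -1⟩, ⟨0, -1⟩, ⟨0, -1⟩, ⟨0, -1⟩, ⟨0, -1⟩]]

/-- All coordinate lists (scale `√30`). -/
def vecs : List (List (Zsqrtd 6)) := rows₁ ++ rows₂

/-- Dot-product histogram of a Petersen row with the other rows: `5` (×6), `-20` (×3), `0` (×2, the poles). -/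
def table₁ : List ((Zsqrtd 6) × ℕ) := [(⟨5, 0⟩, 6), (⟨-20, 0⟩, 3), (⟨0, 0⟩, 2)]

/-- Dot-product histogram of a pole with the other rows: `-30` (×1, the antipode), `0` (×10). -/
def table₂ : List ((Zsqrtd 6) × ℕ) := [(⟨-30, 0⟩, 1), (⟨0, 0⟩, 10)]

/-- Kernel check: `12` coordinate lists. -/
theorem length_vecs : vecs.length = 12 := by decide +kernel

/-- Kernel check: `10` Petersen rows. -/
theorem length_rows₁ : rows₁.length = 10 := by decide +kernel

/-- Kernel check: `2` pole rows. -/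
theorem length_rows₂ : rows₂.length = 2 := by decide +kernel

set_option maxRecDepth 100000 in
/-- Kernel check: every list has length `5` and squared length `30`. -/
theorem shape_vecs : shapeOK vecs 5 (⟨30, 0⟩ : (Zsqrtd 6)) = true := by decide +kernel

/-- Kernel check: Petersen table keys distinct and `≠ q`. -/
theorem keys_table₁ : keysOK table₁ (⟨30, 0⟩ : (Zsqrtd 6)) = true := by decide +kernel

/-- Kernel check: pole table keys distinct and `≠ q`. -/
theorem keys_table₂ : keysOK table₂ (⟨30, 0⟩ : (Zsqrtd 6)) = true := by decide +kernel

set_option maxRecDepth 100000 in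
/-- Kernel check (Petersen rows' distance distribution). -/
theorem hist_rows₁ : histOK vecs table₁ rows₁ = true := by decide +kernel

set_option maxRecDepth 100000 in
/-- Kernel check (pole rows' distance distribution). -/
theorem hist_rows₂ : histOK vecs table₂ rows₂ = true := by decide +kernel

/-- The configuration `X`: the normalised coordinate lists as points of `ℝ⁵`. -/
noncomputable def pts : Finset (EuclideanSpace ℝ (Fin 5)) :=
  config (Zsqrtd.toReal hd) 5 (⟨30, 0⟩ : (Zsqrtd 6)) vecs

/-- `ι q > 0`. -/
theorem hq : 0 < (Zsqrtd.toReal hd) (⟨30, 0⟩ : (Zsqrtd 6)) := by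
  rw [Zsqrtd.toReal_apply]; push_cast; nlinarith [Real.sqrt_nonneg 6, hX]

/-- Node value for the dot product `5`: inner product `1/6`. -/
theorem key_0 : (Zsqrtd.toReal hd) (⟨5, 0⟩ : (Zsqrtd 6)) / (Zsqrtd.toReal hd) (⟨30, 0⟩ : (Zsqrtd 6)) = (1 / 6 : ℝ) := by
  rw [div_eq_iff hq.ne', Zsqrtd.toReal_apply, Zsqrtd.toReal_apply]
  push_cast
  ring

/-- Node value for the dot product `-20`: inner product `-2/3`. -/
theorem key_1 : (Zsqrtd.toReal hd) (⟨-20, 0⟩ : (Zsqrtd 6)) / (Zsqrtd.toReal hd) (⟨30, 0⟩ : (Zsqrtd 6)) = (-2 / 3 : ℝ) := by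
  rw [div_eq_iff hq.ne', Zsqrtd.toReal_apply, Zsqrtd.toReal_apply]
  push_cast
  ring

/-- Node value for the dot product `0`: inner product `0`. -/
theorem key_2 : (Zsqrtd.toReal hd) (⟨0, 0⟩ : (Zsqrtd 6)) / (Zsqrtd.toReal hd) (⟨30, 0⟩ : (Zsqrtd 6)) = (0 : ℝ) := by
  rw [div_eq_iff hq.ne', Zsqrtd.toReal_apply, Zsqrtd.toReal_apply]
  push_cast
  ring

/-- Node value for the dot product `-30`: inner product `-1`. -/
theorem key_3 : (Zsqrtd.toReal hd) (⟨-30, 0⟩ : (Zsqrtd 6)) / (Zsqrtd.toReal hd) (⟨30, 0⟩ : (Zsqrtd 6)) = (-1 : ℝ) := by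
  rw [div_eq_iff hq.ne', Zsqrtd.toReal_apply, Zsqrtd.toReal_apply]
  push_cast
  ring

/-- `X` has `12` points. -/
theorem card_pts : pts.card = 12 := by
  rw [pts, card_eq₂ (Zsqrtd.toReal_injective hd d_not_square) hq shape_vecs keys_table₁ keys_table₂
    hist_rows₁ hist_rows₂ rfl, length_vecs]

/-- Every point of `X` is a unit vector. -/
theorem norm_pts : ∀ x ∈ pts, ‖x‖ = 1 := norm_eq_one hq shape_vecs

/-- **Energy of `X`**: for every potential `a`, `Σ_{x ≠ y ∈ X} a(⟪x,y⟫) = 2 a(-1) + 40 a(0) + 60 a(1/6) + 30 a(-2/3)`. -/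
theorem energy_pts (a : ℝ → ℝ) :
    ∑ x ∈ pts, ∑ y ∈ pts.erase x, a (inner ℝ x y) =
      2 * a (-1 : ℝ) + 40 * a 0 + 60 * a (1 / 6 : ℝ) + 30 * a (-2 / 3 : ℝ) := by
  rw [pts, energy_eq₂ (Zsqrtd.toReal_injective hd d_not_square) hq shape_vecs keys_table₁ keys_table₂
    hist_rows₁ hist_rows₂ rfl a, length_rows₁, length_rows₂]
  simp only [table₁, table₂, List.map_cons, List.map_nil, List.sum_cons, List.sum_nil, Nat.cast_ofNat,
    Nat.cast_one]
  rw [key_0, key_1, key_2, key_3]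
  ring

/-- `X` contains an orthogonal pair (a pole and a Petersen point). -/
theorem exists_orthogonal_pair : ∃ x ∈ pts, ∃ y ∈ pts.erase x, inner ℝ x y = 0 := by
  classical
  have h := energy_pts (fun t => if t = 0 then (1 : ℝ) else 0)
  have h40 : ∑ x ∈ pts, ∑ y ∈ pts.erase x, (fun t => if t = 0 then (1 : ℝ) else 0) (inner ℝ x y) = 40 := by
    rw [h]; norm_num
  have hne : ∑ x ∈ pts, ∑ y ∈ pts.erase x, (fun t => if t = 0 then (1 : ℝ) else 0) (inner ℝ x y) ≠ 0 := by
    rw [h40]; norm_num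
  obtain ⟨x, hx, hx'⟩ := exists_ne_zero_of_sum_ne_zero hne
  obtain ⟨y, hy, hy'⟩ := exists_ne_zero_of_sum_ne_zero hx'
  refine ⟨x, hx, y, hy, ?_⟩
  by_contra h0
  exact hy' (by simp [h0])

/-- **Riesz-2 energy of `X`**: `Σ_{x ≠ y} ‖x - y‖^{-2} = 131/2`. -/
theorem riesz_two_pts : ∑ x ∈ pts, ∑ y ∈ pts.erase x, ‖x - y‖ ^ (-(2 : ℝ)) = 131 / 2 := by
  have hconv : ∑ x ∈ pts, ∑ y ∈ pts.erase x, ‖x - y‖ ^ (-(2 : ℝ)) =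
      ∑ x ∈ pts, ∑ y ∈ pts.erase x, (fun t => (2 - 2 * t)⁻¹) (inner ℝ x y) := by
    refine sum_congr rfl fun x hx => sum_congr rfl fun y hy => ?_
    exact norm_sub_rpow_neg_two (norm_pts x hx) (norm_pts y (mem_of_mem_erase hy))
  rw [hconv]
  refine (energy_pts (fun t => (2 - 2 * t)⁻¹)).trans ?_
  norm_num

/-- **Riesz-4 energy of `X`**: `Σ_{x ≠ y} ‖x - y‖^{-4} = 1377/40`. -/
theorem riesz_four_pts : ∑ x ∈ pts, ∑ y ∈ pts.erase x, ‖x - y‖ ^ (-(4 : ℝ)) = 1377 / 40 := by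
  have hconv : ∑ x ∈ pts, ∑ y ∈ pts.erase x, ‖x - y‖ ^ (-(4 : ℝ)) =
      ∑ x ∈ pts, ∑ y ∈ pts.erase x, (fun t => ((2 - 2 * t) ^ 2)⁻¹) (inner ℝ x y) := by
    refine sum_congr rfl fun x hx => sum_congr rfl fun y hy => ?_
    exact norm_sub_rpow_neg_four (norm_pts x hx) (norm_pts y (mem_of_mem_erase hy))
  rw [hconv]
  refine (energy_pts (fun t => ((2 - 2 * t) ^ 2)⁻¹)).trans ?_
  norm_num

end PetersenPoles

/-- `dipValue 5 2 = 131/2` (`E_2(D_5) = 12(1/4 + 5·5/12 + 5·5/8)`). -/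
theorem dipValue_five_two : dipValue 5 2 = 131 / 2 := by
  have hp : 0 ≤ 2 + 2 / (5 : ℝ) := by norm_num
  have hm : 0 ≤ 2 - 2 / (5 : ℝ) := by norm_num
  rw [dipValue]
  simp only [Nat.cast_ofNat]
  rw [sqrt_rpow_neg_two hp, sqrt_rpow_neg_two hm, Real.rpow_neg (by norm_num : (0 : ℝ) ≤ 2), Real.rpow_two]
  norm_num

/-- `dipValue 5 4 = 1661/48` (`E_4(D_5) = 12(1/16 + 5·25/144 + 5·25/64)`). -/
theorem dipValue_five_four : dipValue 5 4 = 1661 / 48 := by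
  have hp : (0 : ℝ) ≤ 2 + 2 / (5 : ℝ) := by norm_num
  have hm : (0 : ℝ) ≤ 2 - 2 / (5 : ℝ) := by norm_num
  rw [dipValue]
  simp only [Nat.cast_ofNat]
  rw [sqrt_rpow_neg_four hp, sqrt_rpow_neg_four hm, Real.rpow_neg (by norm_num : (0 : ℝ) ≤ 2),
    show (4 : ℝ) = ((4 : ℕ) : ℝ) by norm_num, Real.rpow_natCast]
  norm_num

/-- **`¬ DiploRigid 5 2`: at `s = 2` the diplo-simplex `D_5` is NOT the only configuration at its energy level** — the Petersen
code plus two poles has the same Riesz-2 energy `131/2 = dipValue 5 2` and an orthogonal pair (`0 ∉ {-1, ±1/5}`). -/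
theorem not_diploRigid_five_two : ¬ DiploRigid 5 2 := by
  intro h
  have hle : ∑ x ∈ PetersenPoles.pts, ∑ y ∈ PetersenPoles.pts.erase x, ‖x - y‖ ^ (-(2 : ℝ)) ≤ dipValue 5 2 := by
    rw [PetersenPoles.riesz_two_pts, dipValue_five_two]
  have hZ := h PetersenPoles.pts PetersenPoles.card_pts PetersenPoles.norm_pts hle
  obtain ⟨x, hx, y, hy, h0⟩ := PetersenPoles.exists_orthogonal_pair
  rcases hZ x hx y (mem_of_mem_erase hy) (ne_of_mem_erase hy).symm with h1 | h1 | h1 <;>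
    · rw [h0] at h1; norm_num at h1

/-- **`¬ DiploMinimises 5 4`: for Riesz `s = 4` the diplo-simplex `D_5` is beaten** by the Petersen code plus two poles
(`1377/40 = 34.425 < 1661/48 = 34.604…`). [cite: BallingerEtAl2009, §3.4] -/
theorem not_diploMinimises_five_four : ¬ DiploMinimises 5 4 := by
  intro h
  have hge := h PetersenPoles.pts PetersenPoles.card_pts PetersenPoles.norm_pts
  rw [PetersenPoles.riesz_four_pts, dipValue_five_four] at hge
  norm_num at hge

/-- **CONJECTURE B₅, corrected threshold (gen 26): `s*(5) = 2` exactly.** For `s > 0`, `D_5` (12 points of `S⁴`) minimises the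
Riesz-`s` energy among 12-point subsets of `S⁴` iff `s ≤ 2`; at `s = 2` it ties with the Petersen code plus two poles
(`not_diploRigid_five_two`, kernel), which wins for every probed `s > 2` (kernel at `s = 4`: `not_diploMinimises_five_four`).
Supersedes `ConjectureB5` (`1 ≤ s* < 2`), which the exact tie at `s = 2` makes untenable. OPEN; numerical evidence only for
`s < 2` (no three-point bound of SDP degree ≤ 10 is sharp at `(5, 12)`). -/
@[conjecture] def ConjectureB5two : Prop :=
  ∀ s : ℝ, 0 < s → (DiploMinimises 5 s ↔ s ≤ 2)

/-- The corrected conjecture is consistent with the kernel fact at `s = 4` (sanity wiring). -/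
theorem conjectureB5two_consistent_four (h : ConjectureB5two) : ¬ DiploMinimises 5 4 := fun h4 => by
  have := (h 4 (by norm_num)).1 h4
  norm_num at this

end Summit.Ventures.PackingBounds.Conjectures

end
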